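import Summits.QuantumFields.YangMills.Theorems.SwapVirialDeficitBlowUpGnomonicFollowerFibreDefs
import Mathlib.MeasureTheory.Integral.Pi
import HarnessLib

/-!
# THE MASS OF THE FOLLOWER WEIGHT: `∫ piWeight = (π²)^{|Fol L|} ≤ e^{60L⁴}` — the tail constant of the follower Laplace ceiling
# (free-hands support of ⟨stmt-QuantumFields-24197⟩ `SwapVirialDeficit.SwapGluedStiffness`; LEAD g99 memo11b (4): N2's tail term `e^{−b(m+μR₁²/4)}·∫piWeight`)

w2 g60's ✓`follower_laplace_ceiling` bounds the follower integral by the sharp Gaussian main term plus the flat tail `e^{−b(m + μR₁²/4)}·∫_{V_F} piWeight(gnoFolBlocks y) dy`.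
The assembler needs that mass EXPLICITLY: `integral_gnomonicWeight` (`∫ w = π²`, Bochner form of ✓`Gnomonic.lintegral_gnomonicWeight`), ★ `integral_piWeight`
(`∫_{Fol L → ℝ³} piWeight = (π²)^{|Fol L|}`, Mathlib `integral_fintype_prod_volume_eq_pow`), ★ `integral_piWeight_gnoFolBlocks` (the same on `V_F = GnoFol L` through w2's
volume-preserving ✓`gnoFolBlocksEquiv`), and the exponential form `integral_piWeight_gnoFolBlocks_le_exp` (`≤ e^{60·L⁴}`, `π² ≤ 10 ≤ e^{10}`, `|Fol L| ≤ 6L⁴` ✓`card_fol`).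

HONEST LABEL: bookkeeping; `stub_end_gaussCore` (N2 + shell side + assembly), `stub_core_tip`, ⟨24197⟩ ∕ ⟨24194⟩ OPEN; own crux ⟨22884⟩ `LargeFieldMassRefinementTail` OPEN
(blocked-on ⟨19935⟩); the Yang–Mills mass gap is NOT proved; no summit is proved by a line.  THEOREMS ONLY (0 `def`, 0 `sorry`, no instance), standard axioms.
LEAD seat ym-line-sfw-p2 g99 (cell ym-idea-1, free hands), `--supports stmt-QuantumFields-24197`.  References: [folklore].
-/

set_option autoImplicit false
set_option synthInstance.maxSize 1024

noncomputable section

open MeasureTheory Set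
open scoped BigOperators ENNReal

namespace Summit.QuantumFields.YangMills.Theorems.SwapVirialDeficit.BlowUpRing

open Summit.QuantumFields.YangMills.Theorems.FemtoTransferGap
open Summit.QuantumFields.YangMills.Theorems.FemtoTransferGap.TT
open Summit.QuantumFields.YangMills.Theorems.SwapVirialDeficit.Gnomonic (gnomonicWeight piWeight gnomonicWeight_pos lintegral_gnomonicWeight integrable_gnomonicWeight)

variable {L : ℕ} [NeZero L]

/-- `∫ w = π²` (Bochner form of ✓`lintegral_gnomonicWeight`). [folklore] -/
theorem integral_gnomonicWeight : ∫ v : Fin 3 → ℝ, gnomonicWeight v = Real.pi ^ 2 := by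
  rw [integral_eq_lintegral_of_nonneg_ae (Filter.Eventually.of_forall fun v => (gnomonicWeight_pos v).le) integrable_gnomonicWeight.aestronglyMeasurable,
    lintegral_gnomonicWeight, ENNReal.toReal_ofReal (by positivity)]

/-- ★ `∫_{Fol L → ℝ³} piWeight = (π²)^{|Fol L|}`. [folklore] -/
theorem integral_piWeight : ∫ F : Fol L → Fin 3 → ℝ, piWeight F = (Real.pi ^ 2) ^ Fintype.card (Fol L) := by
  have h := integral_fintype_prod_volume_eq_pow (ι := Fol L) (E := Fin 3 → ℝ) (𝕜 := ℝ) gnomonicWeight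
  rw [integral_gnomonicWeight] at h
  rw [← h]
  rfl

/-- ★ `∫_{V_F} piWeight(gnoFolBlocks y) dy = (π²)^{|Fol L|}` (w2 g60's volume-preserving ✓`gnoFolBlocksEquiv`). [folklore] -/
theorem integral_piWeight_gnoFolBlocks : ∫ y : GnoFol L, piWeight (gnoFolBlocks y) = (Real.pi ^ 2) ^ Fintype.card (Fol L) := by
  have h := (volume_preserving_gnoFolBlocksEquiv (L := L)).integral_comp' (g := fun F : Fol L → Fin 3 → ℝ => piWeight F)
  simp only [gnoFolBlocksEquiv_apply] at h
  rw [h, integral_piWeight]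

/-- `(π²)^{|Fol L|} ≤ e^{60·L⁴}` (`π² ≤ 10`, `|Fol L| ≤ 6L⁴`). [folklore] -/
theorem pi_sq_pow_card_fol_le_exp : (Real.pi ^ 2) ^ Fintype.card (Fol L) ≤ Real.exp (60 * (L : ℝ) ^ 4) := by
  have hπ : Real.pi ^ 2 ≤ Real.exp 10 := by
    have h1 : Real.pi ^ 2 ≤ 10 := by nlinarith [Real.pi_lt_d2, Real.pi_pos]
    have h2 : (10 : ℝ) ≤ Real.exp 10 := by have := Real.add_one_le_exp (10 : ℝ); linarith
    exact h1.trans h2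
  have hcard : (Fintype.card (Fol L) : ℝ) ≤ 6 * (L : ℝ) ^ 4 := by
    rw [card_fol]
    have h : (6 * L ^ 4 - 3 : ℕ) ≤ 6 * L ^ 4 := Nat.sub_le _ _
    exact_mod_cast h
  calc (Real.pi ^ 2) ^ Fintype.card (Fol L) ≤ (Real.exp 10) ^ Fintype.card (Fol L) := pow_le_pow_left₀ (by positivity) hπ _
    _ = Real.exp (10 * (Fintype.card (Fol L) : ℝ)) := by rw [← Real.exp_nat_mul, mul_comm]
    _ ≤ Real.exp (60 * (L : ℝ) ^ 4) := Real.exp_le_exp.2 (by nlinarith)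

/-- ★ **THE FOLLOWER WEIGHT MASS IS AT MOST `e^{60L⁴}`**: `∫_{V_F} piWeight(gnoFolBlocks y) dy ≤ e^{60·L⁴}`. [folklore] -/
theorem integral_piWeight_gnoFolBlocks_le_exp : ∫ y : GnoFol L, piWeight (gnoFolBlocks y) ≤ Real.exp (60 * (L : ℝ) ^ 4) := by
  rw [integral_piWeight_gnoFolBlocks]; exact pi_sq_pow_card_fol_le_exp

end Summit.QuantumFields.YangMills.Theorems.SwapVirialDeficit.BlowUpRing

end
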